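import Summits.ResolutionOfSingularities.ResolutionOfSingularities.Theorems.HilbertSamuelEliminationSigmaMaxModificationsCorridor3WLadderForcedGameTowersDefs
import Summits.ResolutionOfSingularities.ResolutionOfSingularities.Theorems.HilbertSamuelEliminationSigmaMaxModificationsCorridor3WLadderAlgIsolatedBricks
import Summits.ResolutionOfSingularities.ResolutionOfSingularities.Theorems.HilbertSamuelEliminationSigmaMaxModificationsCorridor3WLadderAlgIsolatedScheme
import Summits.ResolutionOfSingularities.ResolutionOfSingularities.Theorems.HilbertSamuelEliminationSigmaMaxModificationsCorridor3WLadderAlgIsolatedHypersurface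
import Summits.ResolutionOfSingularities.ResolutionOfSingularities.Theorems.HilbertSamuelEliminationSigmaMaxModificationsCorridor3WLadderAlgIsolatedTransfer
import Literature.AlgebraicGeometry.Resolution.HilbertSamuelSemicontinuityExcellent
import HarnessLib

/-!
# [OURS · L1 W4.2] C4 P1 `AlgIsolatedOfIsolated` PROVED (W4.2 DEAL D15 «P1 PROOF»; crux `SigmaMaxModifications`
# stmt-ResolutionOfSingularities-18506, conjunct `SigmaMaxModificationsCorridor3` stmt-…-19249; `--supports stmt-…-19249`, helper)

OURS (cell res-hironaka, slot W4.2, seat res-D-pv-042 AS W4.2 DEAL hand D15); NOT a statement of H. Hironaka's manuscript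
[Hironaka2017] nor of [CossartJannsenSaito2020]. AI-drafted, weaker than expert review. Sorry-free PROOF file (no new definition),
fact-free; universe pinned to `0` (the binder `S : Type` of the target forces the stalk and the presentation into one universe only
at `u = 0`, which is the universe of the only caller).

`algIsolatedOfIsolated_holds : IdeasL1C4.AlgIsolatedOfIsolated.{0}` — for `Y` excellent, `y` ISOLATED in `Y_max(3)`, a regular
local `S` of dimension `3` with regular system of parameters `u`, `h ∈ S[X]` monic of degree `m`, `R = S[X]/(h)` local and a flat
local `φ : 𝒪_{Y,y} → R` with `𝔪_y R = 𝔪_R` and trivial residue extension: **`h ∉ (X, u_a, u_b)^m`** (`a ≠ b`).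

Proof (CJS (2.13) «`H_{X̂}(x̂) = H_X(x)`» run through the presentation `φ` instead of the completion). Suppose `h ∈ 𝔮^m`,
`𝔮 = (X, u_a, u_b)`. (1) `φ` is a REGULAR homomorphism (`…AlgIsolatedBricks`: flat, `𝔪_y R = 𝔪_R`, `κ(y) = κ(R)`, `𝒪_{Y,y}`
a G-ring by excellence). (2) `𝔮` and `𝔫 = (𝔪_S, X)` are contractions of `(X)` under coefficient reductions to the domains
`S/(u_a, u_b)` and `κ_S`, so `h` (monic of degree `m`, `h ∈ 𝔮^m ⊆ 𝔫^m`) has order EXACTLY `m` at both, and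
`H^{(0)}[R_Q] = hypersurfaceHFe (k₁+1) m`, `H^{(0)}[R] = hypersurfaceHFe (k₂+1) m` with `k₁ = dim R_Q ≤ 2`, `k₂ = dim R ≤ 3`
(`…AlgIsolatedHypersurface`; `Q = 𝔮R ≠ 𝔪_R` because `u_c ∉ (u_a, u_b)`). (3) Along the regular `φ`: `H^{(0)}[𝒪_y] = H^{(0)}[R]`,
`H^{(t)}[R_Q] = H^{(t+d)}[𝒪_{𝔮₀}]` (`𝔮₀ = Q ∩ 𝒪_y`, `d` the fibre dimension, `dim 𝒪_{𝔮₀} + d = k₁`), and `ψ(𝒪_y) ≥ k₂` because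
`R ≅ S[X]_𝔫/(h)` is equidimensional of dimension `k₂` (`…AlgIsolatedTransfer`). (4) Hence
`H_Y(y) = hypersurfaceHFe (k₂+1+(3-ψ(𝒪_y))) m ≤ hypersurfaceHFe 4 m ≤ H^{(3-ψ)}[𝒪_{𝔮₀}] = H_Y(ζ)` for the generization `ζ ⤳ y`
cut out by `𝔮₀` — contradicting the isolation of `y` in `Y_max(3)` (`…AlgIsolatedScheme`).

## References

* V. Cossart, U. Jannsen, S. Saito, LNM 2270 (2020): Def. 2.28, Lemma 2.37 (2.13), Thm. 2.33. [CossartJannsenSaito2020]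
* H. Matsumura, *Commutative Ring Theory* (1986), Thm. 15.1, Thm. 23.7, §32. [Matsumura1987]
-/

noncomputable section

set_option linter.dupNamespace false -- mandated namespace of this single-conjunct summit

open CategoryTheory AlgebraicGeometry TopologicalSpace IsLocalRing Polynomial
open Literature.AlgebraicGeometry.Resolution Literature.RingTheory.HilbertSamuel
open Literature.AlgebraicGeometry.CossartJannsenSaito2020
open Summit.ResolutionOfSingularities.ResolutionOfSingularities.Theorems.SigmaMaxModificationsCorridor3.Helpers

universe u

namespace Summit.ResolutionOfSingularities.ResolutionOfSingularities.Cruxes.SigmaMaxModifications.IdeasL1C4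

/-! ## Two numerical helpers -/

/-- `ν ≤ ν^{(s)}`. [folklore] -/
theorem self_le_iterPSum (s : ℕ) (ν : ℕ → ℕ) : ν ≤ iterPSum s ν := by
  induction s with
  | zero => rw [iterPSum_zero]
  | succ s ih => exact ih.trans (iterPSum_le_iterPSum_succ s ν)

/-- `hypersurfaceHFe` is monotone in the (positive) embedding dimension. [cite: CossartJannsenSaito2020, Def. 2.13] -/
theorem hypersurfaceHFe_succ_mono {a b : ℕ} (hab : a ≤ b) (m : ℕ) :
    hypersurfaceHFe (a + 1) m ≤ hypersurfaceHFe (b + 1) m := by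
  obtain ⟨c, rfl⟩ := Nat.exists_eq_add_of_le hab
  rw [show a + c + 1 = a + 1 + c by omega, ← iterPSum_hypersurfaceHFe_succ c a m]
  exact self_le_iterPSum c _

/-- The span of a set with at most `n` elements, pushed forward, has `spanFinrank ≤ n`. [folklore] -/
theorem spanFinrank_map_span_le {A B : Type*} [CommRing A] [CommRing B] (f : A →+* B) {s : Set A} (hs : s.Finite)
    {n : ℕ} (hn : s.ncard ≤ n) : ((Ideal.span s).map f).spanFinrank ≤ n := by
  rw [Ideal.map_span]
  exact (Submodule.spanFinrank_span_le_ncard_of_finite (hs.image f)).trans ((Set.ncard_image_le hs).trans hn)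

/-- `edim A_𝔭 ≤ n` when `𝔭` is generated by at most `n` elements. [folklore] -/
theorem spanFinrank_maximalIdeal_localization_le {A : Type*} [CommRing A] (p : Ideal A) [p.IsPrime] {s : Set A}
    (hs : s.Finite) (hp : p = Ideal.span s) {n : ℕ} (hn : s.ncard ≤ n) :
    (maximalIdeal (Localization.AtPrime p)).spanFinrank ≤ n := by
  rw [← Localization.AtPrime.map_eq_maximalIdeal,
    show p.map (algebraMap A (Localization.AtPrime p)) = (Ideal.span s).map (algebraMap A (Localization.AtPrime p)) from
      congrArg _ hp]
  exact spanFinrank_map_span_le _ hs hn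

/-- The closed fibre of a local homomorphism of local rings with noetherian target has a natural-number dimension.
[folklore] -/
theorem exists_nat_ringKrullDim_fibre {A B : Type u} [CommRing A] [CommRing B] [IsLocalRing A] [IsLocalRing B]
    [IsNoetherianRing B] [Algebra A B] [IsLocalHom (algebraMap A B)] :
    ∃ d : ℕ, ringKrullDim (B ⧸ (maximalIdeal A).map (algebraMap A B)) = d := by
  haveI : Nontrivial (B ⧸ (maximalIdeal A).map (algebraMap A B)) :=
    Ideal.Quotient.nontrivial_iff.mpr (map_maximalIdeal_ne_top (R := A) (S := B))
  haveI : IsLocalRing (B ⧸ (maximalIdeal A).map (algebraMap A B)) :=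
    .of_surjective' (Ideal.Quotient.mk _) Ideal.Quotient.mk_surjective
  exact exists_nat_cast_eq_ringKrullDim

/-! ## The theorem -/

/-- **C4 P1 `AlgIsolatedOfIsolated` holds** (universe `0`). See the module docstring for the proof.
[cite: CossartJannsenSaito2020, Lemma 2.37 (2.13), Thm. 2.33] [cite: Matsumura1987, Thm. 15.1, Thm. 23.7] -/
theorem algIsolatedOfIsolated_holds : IdeasL1C4.AlgIsolatedOfIsolated.{0} := by
  intro Y _ hY y hiso S _ _ u h _ φ hdim hu _hsat hloc hflat hmφ hres hmon a b hab hmem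
  -- `m ≥ 1`
  have hm0 : h.natDegree ≠ 0 := by
    intro h0
    have h1 : h = 1 := hmon.natDegree_eq_zero.mp h0
    haveI : Subsingleton (S[X] ⧸ Ideal.span {h}) :=
      Ideal.Quotient.subsingleton_iff.mpr (by rw [h1, Ideal.span_singleton_one])
    exact false_of_nontrivial_of_subsingleton (S[X] ⧸ Ideal.span {h})
  haveI : IsDomain S := isDomain_of_isRegularLocalRing S
  haveI : IsRegularRing S[X] := isRegularRing_polynomial
  -- the algebra `φ`
  letI : Algebra (Y.presheaf.stalk y) (S[X] ⧸ Ideal.span {h}) := φ.toAlgebra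
  haveI : Module.Flat (Y.presheaf.stalk y) (S[X] ⧸ Ideal.span {h}) := hflat
  haveI : IsLocalHom (algebraMap (Y.presheaf.stalk y) (S[X] ⧸ Ideal.span {h})) := hloc
  have hmφ' : (maximalIdeal (Y.presheaf.stalk y)).map (algebraMap (Y.presheaf.stalk y) (S[X] ⧸ Ideal.span {h})) =
      maximalIdeal (S[X] ⧸ Ideal.span {h}) := hmφ
  have hG : IsGRing (Y.presheaf.stalk y) := Scheme.isGRing_stalk_of_isQuasiExcellent hY.isQuasiExcellent y
  have hreg : IsRegularHom (Y.presheaf.stalk y) (S[X] ⧸ Ideal.span {h}) :=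
    isRegularHom_of_flat_of_map_maximalIdeal_eq hG hmφ' hres
  -- the regular system of parameters
  have hd3 : (maximalIdeal S).spanFinrank = 3 := by
    have h1 := IsRegularLocalRing.spanFinrank_maximalIdeal (R := S)
    rw [hdim] at h1
    exact_mod_cast h1
  have hJ : Ideal.span (u '' (↑({a, b} : Finset (Fin 3)) : Set (Fin 3))) = Ideal.span ({u a, u b} : Set S) := by
    rw [Finset.coe_pair, Set.image_pair]
  haveI hJp : (Ideal.span ({u a, u b} : Set S)).IsPrime := hJ ▸ isPrime_span_image hd3 u hu {a, b}
  -- `𝔮 = (X, u_a, u_b)` is the contraction of `(X)` under `ρ : S[X] → (S/(u_a,u_b))[X]`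
  have h𝔮 := span_X_C_C_eq_comap (u a) (u b)
  haveI : (Ideal.span {(X : (S ⧸ Ideal.span ({u a, u b} : Set S))[X])}).IsPrime :=
    (Ideal.span_singleton_prime Polynomial.X_ne_zero).mpr Polynomial.prime_X
  haveI h𝔮p : (Ideal.span ({X, C (u a), C (u b)} : Set S[X])).IsPrime := by
    rw [h𝔮]; exact Ideal.comap_isPrime _ _
  have hord𝔮 := not_mem_comap_pow_succ_of_map_monic (Ideal.Quotient.mk (Ideal.span ({u a, u b} : Set S))) h
    (hmon.map _) (hmon.natDegree_map _) (Ideal.span ({X, C (u a), C (u b)} : Set S[X])) h𝔮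
  -- `Q = 𝔮 R`
  have hh𝔮 : h ∈ Ideal.span ({X, C (u a), C (u b)} : Set S[X]) := Ideal.pow_le_self hm0 hmem
  have hker : RingHom.ker (Ideal.Quotient.mk (Ideal.span {h})) ≤ Ideal.span ({X, C (u a), C (u b)} : Set S[X]) := by
    rw [Ideal.mk_ker]; exact (Ideal.span_singleton_le_iff_mem _).mpr hh𝔮
  set Q : Ideal (S[X] ⧸ Ideal.span {h}) := (Ideal.span ({X, C (u a), C (u b)} : Set S[X])).map
    (Ideal.Quotient.mk (Ideal.span {h})) with hQdef
  haveI hQp : Q.IsPrime := Ideal.map_isPrime_of_surjective Ideal.Quotient.mk_surjective hker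
  have hQcomap : Ideal.span ({X, C (u a), C (u b)} : Set S[X]) = Q.comap (Ideal.Quotient.mk (Ideal.span {h})) := by
    rw [hQdef, Ideal.comap_map_of_surjective _ Ideal.Quotient.mk_surjective, ← RingHom.ker_eq_comap_bot,
      sup_eq_left.mpr hker]
  obtain ⟨hHQ, hdimQ⟩ := hilbertFun_localization_atPrime_quotient h Q _ hQcomap hmem hord𝔮
  -- `𝔫 = (𝔪_S, X)` is the contraction of `(X)` under `S[X] → κ_S[X]`, and is `𝔪_R ∩ S[X]`
  haveI h𝔫max := isMaximal_comap_residue_span_X (S := S)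
  have h𝔮𝔫 : Ideal.span ({X, C (u a), C (u b)} : Set S[X]) ≤
      (Ideal.span {(X : (ResidueField S)[X])}).comap (mapRingHom (residue S)) := by
    rw [Ideal.span_le]
    intro f hf
    rw [SetLike.mem_coe, mem_comap_residue_span_X_iff]
    rcases hf with rfl | rfl | h3
    · rw [Polynomial.coeff_X_zero]; exact zero_mem _
    · rw [Polynomial.coeff_C_zero]; exact mem_maximalIdeal_of_rsop u hu a
    · rw [Set.mem_singleton_iff] at h3
      rw [h3, Polynomial.coeff_C_zero]; exact mem_maximalIdeal_of_rsop u hu b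
  have hh𝔫 : h ∈ (Ideal.span {(X : (ResidueField S)[X])}).comap (mapRingHom (residue S)) ^ h.natDegree :=
    Ideal.pow_right_mono h𝔮𝔫 _ hmem
  have h𝔫eq : (Ideal.span {(X : (ResidueField S)[X])}).comap (mapRingHom (residue S)) =
      (maximalIdeal (S[X] ⧸ Ideal.span {h})).comap (Ideal.Quotient.mk (Ideal.span {h})) :=
    eq_comap_maximalIdeal_of_isMaximal (Ideal.span {h}) _
      ((Ideal.span_singleton_le_iff_mem _).mpr (Ideal.pow_le_self hm0 hh𝔫))
  have hord𝔫 := not_mem_comap_pow_succ_of_map_monic (residue S) h (hmon.map _) (hmon.natDegree_map _)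
    ((Ideal.span {(X : (ResidueField S)[X])}).comap (mapRingHom (residue S))) rfl
  obtain ⟨hHm, hdimm⟩ := hilbertFun_localization_atPrime_quotient h (maximalIdeal (S[X] ⧸ Ideal.span {h})) _ h𝔫eq hh𝔫 hord𝔫
  -- `Q ≠ 𝔪_R`: the third parameter `u_c` lies in `𝔫` but not in `𝔮`
  have hQne : Q ≠ maximalIdeal (S[X] ⧸ Ideal.span {h}) := by
    intro hQm
    obtain ⟨c, -, hc⟩ := Finset.exists_mem_notMem_of_card_lt_card (s := ({a, b} : Finset (Fin 3))) (t := Finset.univ)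
      (by rw [Finset.card_pair hab, Finset.card_univ, Fintype.card_fin]; norm_num)
    have hc' : c ∉ ({a, b} : Set (Fin 3)) := by rwa [← Finset.coe_pair, Finset.mem_coe]
    have hnot := not_mem_span_image_of_not_mem hd3 u hu hc'
    rw [Set.image_pair] at hnot
    have hcn : C (u c) ∈ (Ideal.span {(X : (ResidueField S)[X])}).comap (mapRingHom (residue S)) := by
      rw [mem_comap_residue_span_X_iff, Polynomial.coeff_C_zero]; exact mem_maximalIdeal_of_rsop u hu c
    rw [h𝔫eq, ← hQm, ← hQcomap, h𝔮, mem_comap_mapRingHom_span_X_iff, Polynomial.coeff_C_zero,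
      Ideal.Quotient.eq_zero_iff_mem] at hcn
    exact hnot hcn
  -- `𝔮₀ = Q ∩ 𝒪_y ≠ 𝔪_y`
  have h𝔮₀ne : Q.comap (algebraMap (Y.presheaf.stalk y) (S[X] ⧸ Ideal.span {h})) ≠ maximalIdeal (Y.presheaf.stalk y) := by
    intro heq
    apply hQne
    refine le_antisymm (IsLocalRing.le_maximalIdeal hQp.ne_top) ?_
    rw [← hmφ', ← heq]
    exact Ideal.map_comap_le
  -- the localised algebra `𝒪_{𝔮₀} → R_Q`: flat, local, fibre dimension `d`
  letI : Algebra (Localization.AtPrime (Q.comap (algebraMap (Y.presheaf.stalk y) (S[X] ⧸ Ideal.span {h}))))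
      (Localization.AtPrime Q) :=
    (Localization.localRingHom (Q.comap (algebraMap (Y.presheaf.stalk y) (S[X] ⧸ Ideal.span {h}))) Q
      (algebraMap (Y.presheaf.stalk y) (S[X] ⧸ Ideal.span {h})) rfl).toAlgebra
  haveI : IsLocalHom (algebraMap (Localization.AtPrime (Q.comap (algebraMap (Y.presheaf.stalk y) (S[X] ⧸ Ideal.span {h}))))
      (Localization.AtPrime Q)) :=
    Localization.isLocalHom_localRingHom _ Q (algebraMap (Y.presheaf.stalk y) (S[X] ⧸ Ideal.span {h})) rfl
  haveI : Module.Flat (Localization.AtPrime (Q.comap (algebraMap (Y.presheaf.stalk y) (S[X] ⧸ Ideal.span {h}))))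
      (Localization.AtPrime Q) := by
    have hfl : (algebraMap (Y.presheaf.stalk y) (S[X] ⧸ Ideal.span {h})).Flat := RingHom.flat_algebraMap_iff.mpr inferInstance
    exact hfl.localRingHom Q (Q.comap (algebraMap (Y.presheaf.stalk y) (S[X] ⧸ Ideal.span {h}))) rfl
  obtain ⟨d, hd⟩ := exists_nat_ringKrullDim_fibre
    (A := Localization.AtPrime (Q.comap (algebraMap (Y.presheaf.stalk y) (S[X] ⧸ Ideal.span {h}))))
    (B := Localization.AtPrime Q)
  have hshift := hilbertSamuelFun_localization_eq_of_isRegularHom hreg Q _ rfl hd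
  have hdimsum := ringKrullDim_eq_add_of_flat
    (R := Localization.AtPrime (Q.comap (algebraMap (Y.presheaf.stalk y) (S[X] ⧸ Ideal.span {h}))))
    (S := Localization.AtPrime Q)
  rw [hd] at hdimsum
  -- natural-number bookkeeping of the dimensions
  obtain ⟨k₁, hk₁⟩ := exists_nat_cast_eq_ringKrullDim (R := Localization.AtPrime Q)
  obtain ⟨k₀, hk₀⟩ := exists_nat_cast_eq_ringKrullDim
    (R := Localization.AtPrime (Q.comap (algebraMap (Y.presheaf.stalk y) (S[X] ⧸ Ideal.span {h}))))
  obtain ⟨k₂, hk₂⟩ := exists_nat_cast_eq_ringKrullDim (R := Localization.AtPrime (maximalIdeal (S[X] ⧸ Ideal.span {h})))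
  have hk₁₀ : k₁ = k₀ + d := by
    rw [hk₁, hk₀] at hdimsum; exact_mod_cast hdimsum
  have hd₁ : (maximalIdeal (Localization.AtPrime (Ideal.span ({X, C (u a), C (u b)} : Set S[X])))).spanFinrank = k₁ + 1 := by
    have h1 : ((maximalIdeal (Localization.AtPrime (Ideal.span ({X, C (u a), C (u b)} : Set S[X])))).spanFinrank : WithBot ℕ∞) =
        ringKrullDim (Localization.AtPrime (Ideal.span ({X, C (u a), C (u b)} : Set S[X]))) :=
      IsRegularLocalRing.spanFinrank_maximalIdeal
    rw [← hdimQ, hk₁] at h1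
    exact_mod_cast h1
  have hd₂ : (maximalIdeal (Localization.AtPrime ((Ideal.span {(X : (ResidueField S)[X])}).comap (mapRingHom (residue S))))).spanFinrank = k₂ + 1 := by
    have h1 : ((maximalIdeal (Localization.AtPrime ((Ideal.span {(X : (ResidueField S)[X])}).comap (mapRingHom (residue S))))).spanFinrank : WithBot ℕ∞) =
        ringKrullDim (Localization.AtPrime ((Ideal.span {(X : (ResidueField S)[X])}).comap (mapRingHom (residue S)))) :=
      IsRegularLocalRing.spanFinrank_maximalIdeal
    rw [← hdimm, hk₂] at h1
    exact_mod_cast h1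
  -- `k₁ + 1 ≤ 3`: `𝔮 B_𝔮` is generated by `3` elements
  have hk₁le : k₁ + 1 ≤ 3 := by
    rw [← hd₁]
    refine spanFinrank_maximalIdeal_localization_le _ (Set.toFinite _) rfl ?_
    exact (Set.ncard_insert_le _ _).trans (by
      have := Set.ncard_insert_le (C (u a)) ({C (u b)} : Set S[X]); rw [Set.ncard_singleton] at this; omega)
  -- `k₂ + 1 ≤ 4`: `𝔫 B_𝔫` is generated by `X, u_0, u_1, u_2`
  have h𝔫span : (Ideal.span {(X : (ResidueField S)[X])}).comap (mapRingHom (residue S)) =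
      Ideal.span (insert X (Set.range fun i => C (u i))) := by
    apply le_antisymm
    · intro f hf
      rw [mem_comap_residue_span_X_iff, ← hu] at hf
      rw [← Polynomial.X_mul_divX_add f]
      refine Ideal.add_mem _ (Ideal.mul_mem_right _ _ (Ideal.subset_span (Set.mem_insert _ _))) ?_
      have hle : (Ideal.span (Set.range u)).map (C : S →+* S[X]) ≤ Ideal.span (insert X (Set.range fun i => C (u i))) := by
        rw [Ideal.map_span, ← Set.range_comp]
        exact Ideal.span_mono (Set.subset_insert _ _)
      exact hle (Ideal.mem_map_of_mem _ hf)
    · rw [Ideal.span_le]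
      intro f hf
      rw [SetLike.mem_coe, mem_comap_residue_span_X_iff]
      rcases hf with rfl | ⟨i, rfl⟩
      · rw [Polynomial.coeff_X_zero]; exact zero_mem _
      · rw [Polynomial.coeff_C_zero]; exact mem_maximalIdeal_of_rsop u hu i
  have hk₂le : k₂ + 1 ≤ 4 := by
    rw [← hd₂]
    refine spanFinrank_maximalIdeal_localization_le _ (Set.toFinite _) h𝔫span ?_
    refine (Set.ncard_insert_le _ _).trans ?_
    rw [← Set.image_univ]
    refine Nat.succ_le_succ ((Set.ncard_image_le Set.finite_univ).trans ?_)
    rw [Set.ncard_univ, Nat.card_eq_fintype_card, Fintype.card_fin]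
  -- `ψ(𝒪_{𝔮₀}) ≤ k₀`
  have hψ₀ : minimalPrimesCodim (Localization.AtPrime (Q.comap (algebraMap (Y.presheaf.stalk y) (S[X] ⧸ Ideal.span {h})))) ≤ k₀ := by
    have h1 := minimalPrimesCodim_le_ringKrullDim
      (Localization.AtPrime (Q.comap (algebraMap (Y.presheaf.stalk y) (S[X] ⧸ Ideal.span {h}))))
    rw [hk₀] at h1
    exact_mod_cast h1
  -- `ψ(𝒪_y) ≥ k₂`: `R ≅ B_𝔫/(h)` is equidimensional of dimension `k₂`
  have hg0 : algebraMap S[X] (Localization.AtPrime ((Ideal.span {(X : (ResidueField S)[X])}).comap (mapRingHom (residue S)))) h ≠ 0 := by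
    intro h0
    rw [← map_zero (algebraMap S[X] _)] at h0
    exact hmon.ne_zero (IsLocalization.injective
      (Localization.AtPrime ((Ideal.span {(X : (ResidueField S)[X])}).comap (mapRingHom (residue S))))
      (Ideal.primeCompl_le_nonZeroDivisors ((Ideal.span {(X : (ResidueField S)[X])}).comap (mapRingHom (residue S))))
      h0)
  have hequi := fun P' hP' => ringKrullDim_quotient_eq_of_mem_minimalPrimes_quotient_span_singleton
    (R := Localization.AtPrime ((Ideal.span {(X : (ResidueField S)[X])}).comap (mapRingHom (residue S))))
    (e := k₂ + 1) (by rw [← hdimm, hk₂]; rfl) hg0 (P' := P') hP'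
  -- `R ≃ B_𝔫/(g)`
  obtain ⟨e₁⟩ := exists_ringEquiv_localization_quotient (Ideal.span {h}) (maximalIdeal (S[X] ⧸ Ideal.span {h})) _ h𝔫eq
  have hmapg : (Ideal.span {h}).map (algebraMap S[X] (Localization.AtPrime ((Ideal.span {(X : (ResidueField S)[X])}).comap (mapRingHom (residue S))))) = Ideal.span {algebraMap S[X] _ h} := by
    rw [Ideal.map_span, Set.image_singleton]
  have e₂ : (S[X] ⧸ Ideal.span {h}) ≃+* Localization.AtPrime (maximalIdeal (S[X] ⧸ Ideal.span {h})) :=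
    (IsLocalization.atUnits (S[X] ⧸ Ideal.span {h}) (maximalIdeal (S[X] ⧸ Ideal.span {h})).primeCompl
      (S := Localization.AtPrime (maximalIdeal (S[X] ⧸ Ideal.span {h}))) (by
        intro x hx
        by_contra hnu
        exact hx ((IsLocalRing.mem_maximalIdeal x).mpr hnu))).toRingEquiv
  have e₃ := (e₂.trans e₁.symm).trans (Ideal.quotEquivOfEq hmapg)
  have hequiR : ∀ P ∈ minimalPrimes (S[X] ⧸ Ideal.span {h}),
      ringKrullDim ((S[X] ⧸ Ideal.span {h}) ⧸ P) = ((k₂ + 1 - 1 : ℕ) : WithBot ℕ∞) :=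
    forall_ringKrullDim_quotient_minimalPrimes_of_ringEquiv e₃.symm hequi
  have hψO : k₂ ≤ minimalPrimesCodim (Y.presheaf.stalk y) :=
    le_minimalPrimesCodim_of_flat hmφ' fun P hP => by rw [hequiR P hP, Nat.add_sub_cancel]
  -- `H^{(0)}[𝒪_y] = H^{(0)}[R] = hypersurfaceHFe (k₂+1) m`
  haveI : IsRegularLocalRing ((S[X] ⧸ Ideal.span {h}) ⧸ (maximalIdeal (Y.presheaf.stalk y)).map
      (algebraMap (Y.presheaf.stalk y) (S[X] ⧸ Ideal.span {h}))) := by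
    rw [hmφ']
    letI := Ideal.Quotient.field (maximalIdeal (S[X] ⧸ Ideal.span {h}))
    infer_instance
  have hfib0 : ringKrullDim ((S[X] ⧸ Ideal.span {h}) ⧸ (maximalIdeal (Y.presheaf.stalk y)).map
      (algebraMap (Y.presheaf.stalk y) (S[X] ⧸ Ideal.span {h}))) = (0 : ℕ) := by
    rw [hmφ']
    letI := Ideal.Quotient.field (maximalIdeal (S[X] ⧸ Ideal.span {h}))
    exact_mod_cast ringKrullDim_eq_zero_of_field _
  have hR : hilbertFun (S[X] ⧸ Ideal.span {h}) = hilbertFun (Localization.AtPrime (maximalIdeal (S[X] ⧸ Ideal.span {h}))) :=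
    hilbertFun_eq_of_ringEquiv e₂
  have hO : hilbertFun (S[X] ⧸ Ideal.span {h}) = hilbertSamuelFun (Y.presheaf.stalk y) 0 :=
    hilbertFun_eq_hilbertSamuelFun_of_flat_of_isRegularLocalRing_fiber hfib0
  have hH0 : hilbertFun (Y.presheaf.stalk y) = hypersurfaceHFe (k₂ + 1) h.natDegree := by
    rw [← hilbertSamuelFun_zero, ← hO, hR, hHm, hd₂]
  -- the comparison `H_Y(y) ≤ H^{(3-ψ)}[𝒪_{𝔮₀}]`
  refine not_hsFun_le_of_isIsolatedInHSMaxLocus hiso (Q.comap (algebraMap (Y.presheaf.stalk y) (S[X] ⧸ Ideal.span {h})))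
    h𝔮₀ne ?_
  rw [Scheme.hsFun_def, Scheme.hsPsi]
  set ψO := minimalPrimesCodim (Y.presheaf.stalk y) with hψOdef
  set ψ₀ := minimalPrimesCodim (Localization.AtPrime (Q.comap (algebraMap (Y.presheaf.stalk y) (S[X] ⧸ Ideal.span {h}))))
    with hψ₀def
  have hs : 3 - ψ₀ = (3 - ψ₀ - d) + d := by omega
  rw [hs, ← hshift, hilbertSamuelFun, hilbertSamuelFun, hH0, hHQ, hd₁, iterPSum_hypersurfaceHFe_succ,
    iterPSum_hypersurfaceHFe_succ, show k₂ + 1 + (3 - ψO) = (k₂ + (3 - ψO)) + 1 by omega,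
    show k₁ + 1 + (3 - ψ₀ - d) = (k₁ + (3 - ψ₀ - d)) + 1 by omega]
  exact hypersurfaceHFe_succ_mono (by omega) _

end Summit.ResolutionOfSingularities.ResolutionOfSingularities.Cruxes.SigmaMaxModifications.IdeasL1C4

end
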